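import Summits.QuantumFields.YangMills.Theorems.UnitScaleTiltProp7FlatTransposeTent
import Summits.QuantumFields.YangMills.Theorems.UnitScaleTiltProp7FlatBumpProfile
import Summits.QuantumFields.YangMills.Theorems.UnitScaleTiltProp7FlatProductBump
import Summits.QuantumFields.YangMills.Theorems.UnitScaleTiltProp7FlatBlockRowFactor
import Literature.MathematicalPhysics.QuantumFieldTheory.Balaban1983to89.T3ContinuumYM3Torus
import HarnessLib

/-!
# Route `UnitScaleTilt`, crux K1 «MinimiserStabilityRegPr» (stmt-QuantumFields-19200), route-R E′ S3 ∕ line «HKGK-ANALYTIC», row (R-loc) brick (2d) — THE BLOCKWISE INVERSE ESTIMATE: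
# `Δu = f` on ONE `k`-block `B^k(y)` with `f = (Q_k)ᵀν` (any coarse `ν`) ⇒ `Σ_B f² ≤ C·(L^k)⁻⁴·Σ_B u²`, `C` ABSOLUTE (two interior `C¹` bumps read mean and slope of the affine source through
# `Σ Φ·Δu = Σ (ΔΦ)·u`; no periodisation, no boundary layer, no co-closedness; this seat's LOCATE-RLOC 7deca12a §2, ★w4-19200 g7 01:12:29Z «BRICK 2 GO»)

Cell `ym3-torus`, twin-width seat `ym-ust-19936-w8` (gen 5).  THEOREMS ONLY (0 `def`, 0 `sorry`); `--supports stmt-QuantumFields-19200 --as helper`, count-neutral.  YM₃ on T³ is a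
ladder rung (R3), not the Clay problem; nothing here claims S3, hKg-K, ℛ-ROW★, J-ROW★, E′, the stub, the crux, d = 4 or the mass gap.
INPUTS (✓ in tree): ✓p685407 `transpose_blockSiteK_affine`, ✓p685725 `Prop7FlatBumpProfile`, ✓p686363 `Prop7FlatProductBump`, ✓p686845 `Prop7FlatBlockRowFactor`.
WHAT IS PROVED (ns `…Theorems.Prop7FlatBlockInverseEstimate`; `k ≤ m + K`, `4 ≤ L^k`, `y : Site P k`, component `μ`, `ℓ = L^k`, `X = (ℓ⁴∕16)^{d−1}`):
§1 `one_lt_sitesPerDir_zero`, `sum_prod_mul_marked` (Fubini with one marked coordinate), `even_pairing_eq` (`= m₀·G^d`), `odd_pairing_eq` (`= b·S₂·G^{d−1}`);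
§2 ★★★ `sum_block_sq_transpose_le` — `Σ_{x∈B^k(y)} f⟨x,μ⟩² ≤ 2ℓ^d·(ℓ^d·(d·2ℓ²X)²·(243∕ℓ⁵)^{2d} + ℓ²·ℓ^d·(d·18ℓ³X)²·(243∕ℓ⁵)^{2(d−1)}·(2048∕ℓ⁷)²)·Σ_{x∈B^k(y)} A⟨x,μ⟩²` (`= C_d·ℓ⁻⁴`,
raw form for general `d`); ★★ `sum_block_sq_transpose_le_T3` — `d = 3`: `≤ C₃·ℓ⁻⁴·Σ_B A²`, `C₃ = 2(36·243⁶ + 2916·243⁴·2048²)∕16⁴` (crude, absolute).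
HONEST SCOPE.  Flat, linear, one block; the (R-loc) assembly (this + ✓p684843 `caccioppoli_cutoff_sourced` at `t = ℓ²` with a block-Lipschitz cutoff) is a separate S file; nothing curved.
References: T. Bałaban, CMP 95 (1984) 17–40 [Balaban1984PropagatorsI] ((1.18) p.20, (1.21) p.21, Sect. C p.22); CMP 99 (1985) 389–434 [Balaban1985BackgroundPropagators] (Thm 3.11 p.416);
M. Giaquinta, Princeton UP 1983 [Giaquinta1984] (Ch. III §2).
-/

set_option autoImplicit false

noncomputable section

open scoped BigOperators

namespace Summit.QuantumFields.YangMills.Theorems.Prop7FlatBlockInverseEstimate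

open Literature.MathematicalPhysics.QuantumFieldTheory.Balaban1983to89
open Finset LatticeFieldCalculus
open B5Eq117TorusCarriers (blockSiteK val_blockSiteK sitesPerDir_zero_eq sum_iterBlock_eq)
open B5Eq118OneStroke (iterBlock mem_iterBlock_iff card_iterBlock)
open Summit.QuantumFields.YangMills.Theorems.Prop7FlatTransposeTent (transpose_blockSiteK_affine)
open Summit.QuantumFields.YangMills.Theorems.Prop7FlatBumpProfile
open Summit.QuantumFields.YangMills.Theorems.Prop7FlatProductBump (prod_eq_zero_off laplace_prod_eq_zero_off abs_laplace_prod_le sq_interior_pairing_le)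
open Summit.QuantumFields.YangMills.Theorems.Prop7FlatBlockRowFactor (factor_off d2_factor_off abs_factor_le abs_d2_factor_le factor_blockSiteK rows_iff_mem_iterBlock)

variable {P : Params} {k : ℕ}

/-- `|T^{(0)}| > 1` per direction once `L^k ≥ 2` (`|T^{(0)}| = L^k·|T^{(k)}|`). [cite: Balaban1984PropagatorsI, (1.18) p.20] -/
theorem one_lt_sitesPerDir_zero (hk : k ≤ P.m + P.K) (hℓ : 2 ≤ P.L ^ k) : 1 < P.sitesPerDir 0 := by
  rw [sitesPerDir_zero_eq hk]
  have h1 : 1 ≤ P.sitesPerDir k := Nat.one_le_iff_ne_zero.mpr (P.sitesPerDir_ne_zero k)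
  calc 1 < 2 * 1 := by norm_num
    _ ≤ P.L ^ k * P.sitesPerDir k := Nat.mul_le_mul hℓ h1

/-- **FUBINI FOR SEPARABLE SUMMANDS WITH ONE MARKED COORDINATE**: `Σ_{j : Fin d → Fin ℓ} (Π_i g(j_i))·w(j_μ) = (Σ_r g(r)w(r))·(Σ_r g(r))^{d−1}`. [folklore] -/
theorem sum_prod_mul_marked (d ℓ : ℕ) (μ : Fin d) (g w : Fin ℓ → ℝ) :
    ∑ j : Fin d → Fin ℓ, (∏ i, g (j i)) * w (j μ) = (∑ r, g r * w r) * (∑ r, g r) ^ (d - 1) := by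
  have h1 : ∀ j : Fin d → Fin ℓ, (∏ i, g (j i)) * w (j μ) = ∏ i, (g (j i) * if i = μ then w (j i) else 1) := by
    intro j
    rw [Finset.prod_mul_distrib, Finset.prod_ite_eq']
    simp
  simp_rw [h1]
  rw [show (∑ j : Fin d → Fin ℓ, ∏ i, (g (j i) * if i = μ then w (j i) else 1)) = ∏ i : Fin d, ∑ r : Fin ℓ, (g r * if i = μ then w r else 1) by
    rw [Finset.prod_univ_sum]; simp only [Fintype.piFinset_univ]]
  rw [← Finset.mul_prod_erase Finset.univ _ (Finset.mem_univ μ)]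
  congr 1
  · exact Finset.sum_congr rfl fun r _ => by rw [if_pos rfl]
  · rw [Finset.prod_congr rfl (fun i hi => by rw [show (∑ r : Fin ℓ, g r * if i = μ then w r else 1) = ∑ r, g r from
        Finset.sum_congr rfl fun r _ => by rw [if_neg (Finset.ne_of_mem_erase hi), mul_one]]),
      Finset.prod_const, Finset.card_erase_of_mem (Finset.mem_univ μ), Finset.card_univ, Fintype.card_fin]

/-- **THE EVEN PAIRING READS THE MEAN**: with `G = Σ_r g`, if `Σ_r g(r)(2r − s) = 0` then `Σ_j (Π_i g(j_i))·(m₀ + b·(2j_μ − s)) = m₀·G^d` (for `d ≥ 1`). [folklore] -/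
theorem even_pairing_eq {d ℓ : ℕ} (hd : 1 ≤ d) (μ : Fin d) (g : Fin ℓ → ℝ) (s m₀ b : ℝ) (hodd : ∑ r : Fin ℓ, g r * (2 * (r : ℕ) - s) = 0) :
    ∑ j : Fin d → Fin ℓ, (∏ i, g (j i)) * (m₀ + b * (2 * ((j μ : ℕ) : ℝ) - s)) = m₀ * (∑ r, g r) ^ d := by
  rw [sum_prod_mul_marked d ℓ μ g (fun r => m₀ + b * (2 * ((r : ℕ) : ℝ) - s))]
  have h : ∑ r : Fin ℓ, g r * (m₀ + b * (2 * ((r : ℕ) : ℝ) - s)) = m₀ * ∑ r, g r + b * ∑ r : Fin ℓ, g r * (2 * (r : ℕ) - s) := by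
    rw [Finset.mul_sum, Finset.mul_sum, ← Finset.sum_add_distrib]
    exact Finset.sum_congr rfl fun r _ => by ring
  rw [h, hodd, mul_zero, add_zero, mul_assoc, ← pow_succ', Nat.sub_add_cancel hd]

/-- **THE ODD PAIRING READS THE SLOPE**: `Σ_j (Π_i g(j_i))(2j_μ − s)·(m₀ + b·(2j_μ − s)) = b·S₂·G^{d−1}`, `S₂ = Σ_r g(r)(2r − s)²`, when the odd moment vanishes. [folklore] -/
theorem odd_pairing_eq {d ℓ : ℕ} (μ : Fin d) (g : Fin ℓ → ℝ) (s m₀ b : ℝ) (hodd : ∑ r : Fin ℓ, g r * (2 * (r : ℕ) - s) = 0) :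
    ∑ j : Fin d → Fin ℓ, (∏ i, g (j i)) * ((2 * ((j μ : ℕ) : ℝ) - s) * (m₀ + b * (2 * ((j μ : ℕ) : ℝ) - s)))
      = b * (∑ r : Fin ℓ, g r * (2 * (r : ℕ) - s) ^ 2) * (∑ r, g r) ^ (d - 1) := by
  rw [sum_prod_mul_marked d ℓ μ g (fun r => (2 * ((r : ℕ) : ℝ) - s) * (m₀ + b * (2 * ((r : ℕ) : ℝ) - s)))]
  have h : ∑ r : Fin ℓ, g r * ((2 * ((r : ℕ) : ℝ) - s) * (m₀ + b * (2 * ((r : ℕ) : ℝ) - s)))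
      = m₀ * ∑ r : Fin ℓ, g r * (2 * (r : ℕ) - s) + b * ∑ r : Fin ℓ, g r * (2 * (r : ℕ) - s) ^ 2 := by
    rw [Finset.mul_sum, Finset.mul_sum, ← Finset.sum_add_distrib]
    exact Finset.sum_congr rfl fun r _ => by ring
  rw [h, hodd, mul_zero, zero_add]


/-- ★★★ **THE BLOCKWISE INVERSE ESTIMATE** (general `d`, raw constant): `f` the `Q_k`-transpose of a coarse weight `ν` (pairing `hf`), `laplace 1 (A ·,μ) = f(·,μ)` on the `k`-block `B^k(y)`,
`4 ≤ L^k`.  THEN `Σ_{x∈B^k(y)} f⟨x,μ⟩² ≤ C(d, L^k)·Σ_{x∈B^k(y)} A⟨x,μ⟩²` with the displayed `C(d,ℓ) = C_d·ℓ⁻⁴`, `C_d` absolute — the interpolant's source is `ℓ⁻²` smaller than the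
interpolant, BLOCK BY BLOCK (even bump ⇒ mean, odd bump ⇒ slope, interior duality, Cauchy–Schwarz, the profile's moments). [cite: Balaban1984PropagatorsI, (1.18) p.20, (1.21) p.21, Sect. C p.22;
Giaquinta1984, Ch. III §2] -/
theorem sum_block_sq_transpose_le (hk : k ≤ P.m + P.K) (hℓ4 : 4 ≤ P.L ^ k) (ν : PBond P k → ℝ) (A f : PBond P 0 → ℝ)
    (hf : ∀ Y : PBond P 0 → ℝ, ∑ c : PBond P k, ν c * bondAvgIter k Y c = ∑ b : PBond P 0, f b * Y b)
    (y : Site P k) (μ : Fin P.d) (hLap : ∀ x ∈ iterBlock k y, laplace 1 (fun z => A ⟨z, μ⟩) x = f ⟨x, μ⟩) :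
    ∑ x ∈ iterBlock k y, f ⟨x, μ⟩ ^ 2
      ≤ (2 * ((P.L : ℝ) ^ k) ^ P.d *
          (((P.L : ℝ) ^ k) ^ P.d * ((P.d : ℝ) * (2 * ((P.L : ℝ) ^ k) ^ 2 * ((((P.L : ℝ) ^ k) ^ 4 / 16) ^ (P.d - 1)))) ^ 2
              * (243 / ((P.L : ℝ) ^ k) ^ 5) ^ (2 * P.d)
            + ((P.L : ℝ) ^ k) ^ 2 * ((P.L : ℝ) ^ k) ^ P.d * ((P.d : ℝ) * (18 * ((P.L : ℝ) ^ k) ^ 3 * ((((P.L : ℝ) ^ k) ^ 4 / 16) ^ (P.d - 1)))) ^ 2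
              * (243 / ((P.L : ℝ) ^ k) ^ 5) ^ (2 * (P.d - 1)) * (2048 / ((P.L : ℝ) ^ k) ^ 7) ^ 2))
        * ∑ x ∈ iterBlock k y, A ⟨x, μ⟩ ^ 2 := by
  classical
  set ℓ : ℕ := P.L ^ k with hℓdef
  have hℓ2 : 2 ≤ ℓ := le_trans (by norm_num) hℓ4
  have hℓ3 : 3 ≤ ℓ := le_trans (by norm_num) hℓ4
  set s : ℕ := ℓ - 1 with hsdef
  have hsℓ : s + 1 = ℓ := by omega
  have hℓN : ℓ ∣ P.sitesPerDir 0 := ⟨P.sitesPerDir k, sitesPerDir_zero_eq hk⟩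
  haveI : Fact (1 < P.sitesPerDir 0) := ⟨one_lt_sitesPerDir_zero hk hℓ2⟩
  have hd : 1 ≤ P.d := P.hd
  set L : ℝ := (P.L : ℝ) ^ k with hLdef
  have hLℓ : ((ℓ : ℕ) : ℝ) = L := by rw [hℓdef, hLdef]; push_cast; rfl
  have hsR : ((s : ℕ) : ℝ) = L - 1 := by
    rw [← hLℓ, ← hsℓ]; push_cast; ring
  have hL4 : (4 : ℝ) ≤ L := by rw [← hLℓ]; exact_mod_cast hℓ4
  have hL0 : (0 : ℝ) ≤ L := by linarith only [hL4]
  set X : ℝ := (L ^ 4 / 16) ^ (P.d - 1) with hXdef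
  have hX0 : 0 ≤ X := by positivity
  set g : ℕ → ℝ := fun r => ((r : ℕ) : ℝ) ^ 2 * (((s : ℕ) : ℝ) - r) ^ 2 with hgdef
  set h : ℕ → ℝ := fun r => ((r : ℕ) : ℝ) ^ 2 * (((s : ℕ) : ℝ) - r) ^ 2 * (2 * ((r : ℕ) : ℝ) - s) with hhdef
  have hg0 : g 0 = 0 := by simp [hgdef]
  have hgl : g (ℓ - 1) = 0 := by simp [hgdef, hsdef]
  have hh0 : h 0 = 0 := by simp [hhdef]
  have hhl : h (ℓ - 1) = 0 := by simp [hhdef, hsdef]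
  have hrs : ∀ r : ℕ, r < ℓ → (0 : ℝ) ≤ r ∧ ((r : ℕ) : ℝ) ≤ ((s : ℕ) : ℝ) ∧ ((s : ℕ) : ℝ) + 1 ≤ L := fun r hr =>
    ⟨Nat.cast_nonneg r, by exact_mod_cast (by omega : r ≤ s), by rw [hsR]; linarith only []⟩
  have hMg : ∀ r, r < ℓ → |g r| ≤ L ^ 4 / 16 := fun r hr => by
    obtain ⟨h1, h2, h3⟩ := hrs r hr
    simp only [hgdef]
    rw [abs_of_nonneg (profile_nonneg _ _)]
    exact profile_le h1 h2 (by linarith only [h3])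
  have hMh : ∀ r, r < ℓ → |h r| ≤ L ^ 5 / 16 := fun r hr => by
    obtain ⟨h1, h2, h3⟩ := hrs r hr
    simp only [hhdef]
    exact abs_profile_odd_le h1 h2 h3
  have hs0 : (0 : ℝ) ≤ ((s : ℕ) : ℝ) := Nat.cast_nonneg s
  have hs1L : ((s : ℕ) : ℝ) + 1 ≤ L := by rw [hsR]; linarith only []
  have hKg_int : ∀ r, 1 ≤ r → r ≤ ℓ - 2 → |2 * g r - g (r + 1) - g (r - 1)| ≤ 2 * L ^ 2 := by
    intro r h1 h2
    obtain ⟨a1, a2, a3⟩ := hrs r (by omega)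
    have e1 : (((r + 1 : ℕ)) : ℝ) = (r : ℝ) + 1 := by push_cast; ring
    have e2 : (((r - 1 : ℕ)) : ℝ) = (r : ℝ) - 1 := by rw [Nat.cast_sub h1]; push_cast; ring
    simp only [hgdef]
    rw [e1, e2]
    exact abs_d2_profile_le a1 a2 a3
  have hKg_first : |2 * g 0 - g 1| ≤ 2 * L ^ 2 := by
    rw [hg0, mul_zero, zero_sub, abs_neg]
    simp only [hgdef]
    push_cast
    rw [abs_of_nonneg (profile_nonneg _ _)]
    have h1 := abs_bdry_profile_le hs0 hs1L
    have h2 : (0:ℝ) ≤ L ^ 2 := by positivity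
    linarith only [h1, h2]
  have hKg_last : |2 * g (ℓ - 1) - g (ℓ - 2)| ≤ 2 * L ^ 2 := by
    rw [hgl, mul_zero, zero_sub, abs_neg]
    have e2 : (((ℓ - 2 : ℕ)) : ℝ) = ((s : ℕ) : ℝ) - 1 := by
      rw [hsR, ← hLℓ, Nat.cast_sub hℓ2]; push_cast; ring
    simp only [hgdef]
    rw [e2, profile_sub_one, abs_of_nonneg (profile_nonneg _ _)]
    have h1 := abs_bdry_profile_le hs0 hs1L
    have h2 : (0:ℝ) ≤ L ^ 2 := by positivity
    linarith only [h1, h2]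
  have hs1 : (1 : ℝ) ≤ ((s : ℕ) : ℝ) := by rw [hsR]; linarith only [hL4]
  have hKh_int : ∀ r, 1 ≤ r → r ≤ ℓ - 2 → |2 * h r - h (r + 1) - h (r - 1)| ≤ 18 * L ^ 3 := by
    intro r h1 h2
    obtain ⟨a1, a2, a3⟩ := hrs r (by omega)
    have e1 : (((r + 1 : ℕ)) : ℝ) = (r : ℝ) + 1 := by push_cast; ring
    have e2 : (((r - 1 : ℕ)) : ℝ) = (r : ℝ) - 1 := by rw [Nat.cast_sub h1]; push_cast; ring
    simp only [hhdef]
    rw [e1, e2]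
    exact abs_d2_profile_odd_le a1 a2 a3
  have hKh_first : |2 * h 0 - h 1| ≤ 18 * L ^ 3 := by
    rw [hh0, mul_zero, zero_sub, abs_neg]
    simp only [hhdef]
    push_cast
    have h1 := (abs_le.mp (abs_bdry_profile_odd_le hs1 hs1L))
    have hL3 : 0 ≤ L ^ 3 := by positivity
    rw [abs_le]; constructor <;> linarith only [h1.1, h1.2, hL3]
  have hKh_last : |2 * h (ℓ - 1) - h (ℓ - 2)| ≤ 18 * L ^ 3 := by
    rw [hhl, mul_zero, zero_sub, abs_neg]
    have e2 : (((ℓ - 2 : ℕ)) : ℝ) = ((s : ℕ) : ℝ) - 1 := by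
      rw [hsR, ← hLℓ, Nat.cast_sub hℓ2]; push_cast; ring
    simp only [hhdef]
    rw [e2, profile_odd_sub_one, abs_neg]
    have h1 := abs_bdry_profile_odd_le hs1 hs1L
    have hL3 : 0 ≤ L ^ 3 := by positivity
    linarith only [h1, hL3]
  set Wg : Fin P.d → ZMod (P.sitesPerDir 0) → ℝ := fun i a => if a.val / ℓ = (y i).val then g (a.val % ℓ) else 0 with hWg
  set Wh : Fin P.d → ZMod (P.sitesPerDir 0) → ℝ := fun i a =>
    if i = μ then (if a.val / ℓ = (y μ).val then h (a.val % ℓ) else 0) else (if a.val / ℓ = (y i).val then g (a.val % ℓ) else 0) with hWh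
  have hW0g : ∀ (i : Fin P.d) (a : ZMod (P.sitesPerDir 0)), ¬ (a.val / ℓ = (y i).val) → Wg i a = 0 := fun i a ha => by
    simp only [hWg]; exact factor_off _ g a ha
  have hD0g : ∀ (i : Fin P.d) (a : ZMod (P.sitesPerDir 0)), ¬ (a.val / ℓ = (y i).val) → 2 * Wg i a - Wg i (a + 1) - Wg i (a - 1) = 0 := fun i a ha => by
    simp only [hWg]; exact d2_factor_off hℓN hℓ2 _ g hg0 hgl a ha
  have hMg' : ∀ (i : Fin P.d) (a : ZMod (P.sitesPerDir 0)), |Wg i a| ≤ L ^ 4 / 16 := fun i a => by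
    simp only [hWg]; exact abs_factor_le hℓ2 _ g (by positivity) hMg a
  have hKg' : ∀ (i : Fin P.d) (a : ZMod (P.sitesPerDir 0)), |2 * Wg i a - Wg i (a + 1) - Wg i (a - 1)| ≤ 2 * L ^ 2 := fun i a => by
    simp only [hWg]; exact abs_d2_factor_le hℓN hℓ2 _ g hg0 hgl (by positivity) hKg_int hKg_first hKg_last a
  have hW0h : ∀ (i : Fin P.d) (a : ZMod (P.sitesPerDir 0)), ¬ (a.val / ℓ = (y i).val) → Wh i a = 0 := fun i a ha => by
    by_cases hi : i = μ
    · subst hi; simp only [hWh, if_true]; exact factor_off _ h a ha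
    · simp only [hWh, if_neg hi]; exact factor_off _ g a ha
  have hD0h : ∀ (i : Fin P.d) (a : ZMod (P.sitesPerDir 0)), ¬ (a.val / ℓ = (y i).val) → 2 * Wh i a - Wh i (a + 1) - Wh i (a - 1) = 0 := fun i a ha => by
    by_cases hi : i = μ
    · subst hi; simp only [hWh, if_true]; exact d2_factor_off hℓN hℓ2 _ h hh0 hhl a ha
    · simp only [hWh, if_neg hi]; exact d2_factor_off hℓN hℓ2 _ g hg0 hgl a ha
  have hMh' : ∀ (i : Fin P.d) (a : ZMod (P.sitesPerDir 0)), |Wh i a| ≤ L ^ 4 / 16 * (if i = μ then L else 1) := fun i a => by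
    by_cases hi : i = μ
    · subst hi; simp only [hWh, if_true]
      have e : L ^ 4 / 16 * L = L ^ 5 / 16 := by ring
      rw [e]; exact abs_factor_le hℓ2 _ h (by positivity) hMh a
    · simp only [hWh, if_neg hi, mul_one]; exact abs_factor_le hℓ2 _ g (by positivity) hMg a
  have hKh' : ∀ (i : Fin P.d) (a : ZMod (P.sitesPerDir 0)), |2 * Wh i a - Wh i (a + 1) - Wh i (a - 1)| ≤ (if i = μ then 18 * L ^ 3 else 2 * L ^ 2) := fun i a => by
    by_cases hi : i = μ
    · subst hi; simp only [hWh, if_true]; exact abs_d2_factor_le hℓN hℓ2 _ h hh0 hhl (by positivity) hKh_int hKh_first hKh_last a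
    · simp only [hWh, if_neg hi]; exact abs_d2_factor_le hℓN hℓ2 _ g hg0 hgl (by positivity) hKg_int hKg_first hKg_last a
  set S : Finset (Site P 0) := iterBlock k y with hSdef
  have hnotS : ∀ x : Site P 0, x ∉ S → ¬ ∀ i : Fin P.d, (x i).val / ℓ = (y i).val := fun x hx hall =>
    hx ((rows_iff_mem_iterBlock hk y x).mp hall)
  have hΦS : ∀ x : Site P 0, x ∉ S → (fun z : Site P 0 => ∏ i, Wg i (z i)) x = 0 := fun x hx =>
    prod_eq_zero_off Wg (fun i a => a.val / ℓ = (y i).val) hW0g x (hnotS x hx)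
  have hΔΦS : ∀ x : Site P 0, x ∉ S → laplace 1 (fun z : Site P 0 => ∏ i, Wg i (z i)) x = 0 := fun x hx =>
    laplace_prod_eq_zero_off Wg (fun i a => a.val / ℓ = (y i).val) hW0g hD0g x (hnotS x hx)
  have hΨS : ∀ x : Site P 0, x ∉ S → (fun z : Site P 0 => ∏ i, Wh i (z i)) x = 0 := fun x hx =>
    prod_eq_zero_off Wh (fun i a => a.val / ℓ = (y i).val) hW0h x (hnotS x hx)
  have hΔΨS : ∀ x : Site P 0, x ∉ S → laplace 1 (fun z : Site P 0 => ∏ i, Wh i (z i)) x = 0 := fun x hx =>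
    laplace_prod_eq_zero_off Wh (fun i a => a.val / ℓ = (y i).val) hW0h hD0h x (hnotS x hx)
  have hAΦ : ∀ x ∈ S, |laplace 1 (fun z : Site P 0 => ∏ i, Wg i (z i)) x| ≤ (P.d : ℝ) * (2 * L ^ 2 * X) := by
    intro x _
    refine (abs_laplace_prod_le Wg (fun _ => L ^ 4 / 16) (fun _ => 2 * L ^ 2) hMg' hKg' x).trans (le_of_eq ?_)
    simp only [Finset.prod_const, Finset.card_erase_of_mem (Finset.mem_univ _), Finset.card_univ, Fintype.card_fin, Finset.sum_const,
      nsmul_eq_mul, hXdef]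
  have hAΨ : ∀ x ∈ S, |laplace 1 (fun z : Site P 0 => ∏ i, Wh i (z i)) x| ≤ (P.d : ℝ) * (18 * L ^ 3 * X) := by
    intro x _
    refine (abs_laplace_prod_le Wh (fun i => L ^ 4 / 16 * (if i = μ then L else 1)) (fun i => if i = μ then 18 * L ^ 3 else 2 * L ^ 2) hMh' hKh' x).trans ?_
    have hterm : ∀ μ' : Fin P.d, (if μ' = μ then 18 * L ^ 3 else 2 * L ^ 2) * ∏ i ∈ Finset.univ.erase μ', (L ^ 4 / 16 * (if i = μ then L else 1))
        ≤ 18 * L ^ 3 * X := by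
      intro μ'
      rw [Finset.prod_mul_distrib, Finset.prod_const, Finset.card_erase_of_mem (Finset.mem_univ _), Finset.card_univ, Fintype.card_fin,
        Finset.prod_ite_eq']
      by_cases hμ' : μ' = μ
      · subst hμ'
        rw [if_pos rfl, if_neg (Finset.notMem_erase μ' _), mul_one]
      · rw [if_neg hμ', if_pos (Finset.mem_erase.mpr ⟨Ne.symm hμ', Finset.mem_univ _⟩)]
        have hL1 : (2 : ℝ) * L ^ 2 * (X * L) = 2 * L ^ 3 * X := by ring
        rw [hL1]
        have hL3 : 0 ≤ L ^ 3 := pow_nonneg hL0 3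
        have : 2 * L ^ 3 * X ≤ 18 * L ^ 3 * X := by
          have := mul_nonneg hL3 hX0
          linarith only [this]
        exact this
    calc ∑ μ' : Fin P.d, (if μ' = μ then 18 * L ^ 3 else 2 * L ^ 2) * ∏ i ∈ Finset.univ.erase μ', (L ^ 4 / 16 * (if i = μ then L else 1))
        ≤ ∑ _μ' : Fin P.d, 18 * L ^ 3 * X := Finset.sum_le_sum fun μ' _ => hterm μ'
      _ = (P.d : ℝ) * (18 * L ^ 3 * X) := by rw [Finset.sum_const, Finset.card_univ, Fintype.card_fin, nsmul_eq_mul]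
  have E1 := sq_interior_pairing_le (fun z : Site P 0 => ∏ i, Wg i (z i)) (fun z => A ⟨z, μ⟩) (fun z => f ⟨z, μ⟩) S hΦS hΔΦS hLap hAΦ
  have E2 := sq_interior_pairing_le (fun z : Site P 0 => ∏ i, Wh i (z i)) (fun z => A ⟨z, μ⟩) (fun z => f ⟨z, μ⟩) S hΨS hΔΨS hLap hAΨ
  have hcard : (S.card : ℝ) = L ^ P.d := by
    rw [hSdef, card_iterBlock k hk y]; push_cast; rw [hLdef, ← pow_mul, ← pow_mul, mul_comm]
  rw [hcard] at E1 E2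
  set α : ℝ := ((((P.L : ℝ) ^ (P.d + 1)) ^ k)⁻¹) * (ν ⟨y, μ⟩ + (((P.L ^ k : ℕ) : ℝ) - 1) * ν ⟨y.unshift μ, μ⟩) with hαdef
  set β : ℝ := ((((P.L : ℝ) ^ (P.d + 1)) ^ k)⁻¹) * (ν ⟨y, μ⟩ - ν ⟨y.unshift μ, μ⟩) with hβdef
  have hfj : ∀ j : Fin P.d → Fin (P.L ^ k), f ⟨blockSiteK k y j, μ⟩ = α + β * ((j μ : ℕ) : ℝ) := fun j => by
    rw [transpose_blockSiteK_affine hk ν f hf y j μ]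
  set b : ℝ := β / 2 with hbdef
  set m₀ : ℝ := α + b * ((s : ℕ) : ℝ) with hm₀def
  have hfj' : ∀ j : Fin P.d → Fin (P.L ^ k), f ⟨blockSiteK k y j, μ⟩ = m₀ + b * (2 * ((j μ : ℕ) : ℝ) - s) := fun j => by
    rw [hfj j, hm₀def, hbdef]; ring
  have hΦj : ∀ j : Fin P.d → Fin (P.L ^ k), (∏ i, Wg i ((blockSiteK k y j) i)) = ∏ i, g (j i) := fun j =>
    Finset.prod_congr rfl fun i _ => by simp only [hWg]; exact factor_blockSiteK hk y j g i
  have hΨj : ∀ j : Fin P.d → Fin (P.L ^ k), (∏ i, Wh i ((blockSiteK k y j) i)) = (∏ i, g (j i)) * (2 * ((j μ : ℕ) : ℝ) - s) := fun j => by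
    have h1 : (∏ i, Wh i ((blockSiteK k y j) i)) = ∏ i, (g (j i) * (if i = μ then (2 * ((j i : ℕ) : ℝ) - s) else 1)) := by
      refine Finset.prod_congr rfl fun i _ => ?_
      by_cases hi : i = μ
      · subst hi
        simp only [hWh, if_true]
        rw [factor_blockSiteK hk y j h i]
      · simp only [hWh, if_neg hi, mul_one]
        exact factor_blockSiteK hk y j g i
    rw [h1, Finset.prod_mul_distrib, Finset.prod_ite_eq']
    simp
  have hodd : ∑ r : Fin (P.L ^ k), g r * (2 * ((r : ℕ) : ℝ) - s) = 0 := by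
    rw [Fin.sum_univ_eq_sum_range (fun r => g r * (2 * ((r : ℕ) : ℝ) - s)) (P.L ^ k)]
    have := sum_profile_odd_moment_eq_zero s
    rw [hsℓ] at this
    simp only [hgdef]
    exact this
  have hG : L ^ 5 / 243 ≤ ∑ r : Fin (P.L ^ k), g r := by
    rw [Fin.sum_univ_eq_sum_range (fun r => g r) (P.L ^ k)]
    have := sum_profile_ge hℓ3
    rw [hLℓ] at this
    simp only [hgdef, hsdef]
    exact this
  have hS2 : L ^ 7 / 2048 ≤ ∑ r : Fin (P.L ^ k), g r * (2 * ((r : ℕ) : ℝ) - s) ^ 2 := by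
    rw [Fin.sum_univ_eq_sum_range (fun r => g r * (2 * ((r : ℕ) : ℝ) - s) ^ 2) (P.L ^ k)]
    have := sum_profile_sq_moment_ge hℓ4
    rw [hLℓ] at this
    simp only [hgdef, hsdef]
    exact this
  have hPe : ∑ x ∈ S, (fun z : Site P 0 => ∏ i, Wg i (z i)) x * (fun z => f ⟨z, μ⟩) x = m₀ * (∑ r : Fin (P.L ^ k), g r) ^ P.d := by
    rw [hSdef, sum_iterBlock_eq hk y]
    simp only []
    rw [Finset.sum_congr rfl fun j _ => by rw [hΦj j, hfj' j]]
    exact even_pairing_eq hd μ (fun r => g r) _ m₀ b hodd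
  have hPo : ∑ x ∈ S, (fun z : Site P 0 => ∏ i, Wh i (z i)) x * (fun z => f ⟨z, μ⟩) x
      = b * (∑ r : Fin (P.L ^ k), g r * (2 * ((r : ℕ) : ℝ) - s) ^ 2) * (∑ r : Fin (P.L ^ k), g r) ^ (P.d - 1) := by
    rw [hSdef, sum_iterBlock_eq hk y]
    simp only []
    rw [Finset.sum_congr rfl fun j _ => by rw [hΨj j, hfj' j, mul_assoc]]
    exact odd_pairing_eq μ (fun r => g r) _ m₀ b hodd
  rw [hPe] at E1
  rw [hPo] at E2
  set G : ℝ := ∑ r : Fin (P.L ^ k), g r with hGdef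
  set T : ℝ := ∑ r : Fin (P.L ^ k), g r * (2 * ((r : ℕ) : ℝ) - s) ^ 2 with hTdef
  set U : ℝ := ∑ x ∈ S, A ⟨x, μ⟩ ^ 2 with hUdef
  have hU0 : 0 ≤ U := Finset.sum_nonneg fun x _ => sq_nonneg _
  have hL5 : 0 < L ^ 5 / 243 := by positivity
  have hG0 : 0 < G := lt_of_lt_of_le hL5 hG
  have hT0 : 0 < T := lt_of_lt_of_le (by positivity) hS2
  have hLpos : 0 < L := by linarith only [hL4]
  have hq : 1 ≤ G * (243 / L ^ 5) := by
    rw [← div_le_iff₀ (by positivity)]; rw [one_div, inv_div]; exact hG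
  have hq' : 1 ≤ T * (2048 / L ^ 7) := by
    rw [← div_le_iff₀ (by positivity)]; rw [one_div, inv_div]; exact hS2
  have hm : m₀ ^ 2 ≤ L ^ P.d * ((P.d : ℝ) * (2 * L ^ 2 * X)) ^ 2 * U * (243 / L ^ 5) ^ (2 * P.d) := by
    have h1 : m₀ ^ 2 ≤ m₀ ^ 2 * (G * (243 / L ^ 5)) ^ (2 * P.d) := le_mul_of_one_le_right (sq_nonneg _) (one_le_pow₀ hq)
    have h2 : m₀ ^ 2 * (G * (243 / L ^ 5)) ^ (2 * P.d) = (m₀ * G ^ P.d) ^ 2 * (243 / L ^ 5) ^ (2 * P.d) := by ring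
    rw [h2] at h1
    exact h1.trans (mul_le_mul_of_nonneg_right E1 (by positivity))
  have hb : b ^ 2 ≤ L ^ P.d * ((P.d : ℝ) * (18 * L ^ 3 * X)) ^ 2 * U * (243 / L ^ 5) ^ (2 * (P.d - 1)) * (2048 / L ^ 7) ^ 2 := by
    have h1 : b ^ 2 ≤ b ^ 2 * ((T * (2048 / L ^ 7)) ^ 2 * (G * (243 / L ^ 5)) ^ (2 * (P.d - 1))) :=
      le_mul_of_one_le_right (sq_nonneg _) (one_le_mul_of_one_le_of_one_le (one_le_pow₀ hq') (one_le_pow₀ hq))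
    have h2 : b ^ 2 * ((T * (2048 / L ^ 7)) ^ 2 * (G * (243 / L ^ 5)) ^ (2 * (P.d - 1)))
        = (b * T * G ^ (P.d - 1)) ^ 2 * (243 / L ^ 5) ^ (2 * (P.d - 1)) * (2048 / L ^ 7) ^ 2 := by ring
    rw [h2] at h1
    exact h1.trans (mul_le_mul_of_nonneg_right (mul_le_mul_of_nonneg_right E2 (by positivity)) (by positivity))
  have hfsq : ∀ j : Fin P.d → Fin (P.L ^ k), f ⟨blockSiteK k y j, μ⟩ ^ 2 ≤ 2 * m₀ ^ 2 + 2 * (b ^ 2 * L ^ 2) := by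
    intro j
    rw [hfj' j]
    obtain ⟨a1, a2, a3⟩ := hrs (j μ) (j μ).isLt
    have hq2 : (2 * ((j μ : ℕ) : ℝ) - s) ^ 2 ≤ L ^ 2 := sq_two_mul_sub_le a1 a2 a3
    have h1 : (m₀ + b * (2 * ((j μ : ℕ) : ℝ) - s)) ^ 2 ≤ 2 * m₀ ^ 2 + 2 * (b * (2 * ((j μ : ℕ) : ℝ) - s)) ^ 2 := by
      have h0 := sq_nonneg (m₀ - b * (2 * ((j μ : ℕ) : ℝ) - s))
      have e : 2 * m₀ ^ 2 + 2 * (b * (2 * ((j μ : ℕ) : ℝ) - s)) ^ 2 - (m₀ + b * (2 * ((j μ : ℕ) : ℝ) - s)) ^ 2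
          = (m₀ - b * (2 * ((j μ : ℕ) : ℝ) - s)) ^ 2 := by ring
      linarith only [h0, e]
    have h2 : (b * (2 * ((j μ : ℕ) : ℝ) - s)) ^ 2 ≤ b ^ 2 * L ^ 2 := by
      rw [mul_pow]; exact mul_le_mul_of_nonneg_left hq2 (sq_nonneg b)
    linarith only [h1, h2]
  have hsum : ∑ x ∈ S, f ⟨x, μ⟩ ^ 2 ≤ L ^ P.d * (2 * m₀ ^ 2 + 2 * (b ^ 2 * L ^ 2)) := by
    rw [hSdef, sum_iterBlock_eq hk y]
    calc ∑ j : Fin P.d → Fin (P.L ^ k), f ⟨blockSiteK k y j, μ⟩ ^ 2 ≤ ∑ _j : Fin P.d → Fin (P.L ^ k), (2 * m₀ ^ 2 + 2 * (b ^ 2 * L ^ 2)) :=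
          Finset.sum_le_sum fun j _ => hfsq j
      _ = L ^ P.d * (2 * m₀ ^ 2 + 2 * (b ^ 2 * L ^ 2)) := by
          rw [Finset.sum_const, Finset.card_univ, Fintype.card_fun, Fintype.card_fin, Fintype.card_fin, nsmul_eq_mul]
          push_cast
          rw [hLdef, ← pow_mul, mul_comm k, pow_mul]
  have hLd : 0 ≤ L ^ P.d := by positivity
  calc ∑ x ∈ S, f ⟨x, μ⟩ ^ 2 ≤ L ^ P.d * (2 * m₀ ^ 2 + 2 * (b ^ 2 * L ^ 2)) := hsum
    _ ≤ L ^ P.d * (2 * (L ^ P.d * ((P.d : ℝ) * (2 * L ^ 2 * X)) ^ 2 * U * (243 / L ^ 5) ^ (2 * P.d))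
          + 2 * ((L ^ P.d * ((P.d : ℝ) * (18 * L ^ 3 * X)) ^ 2 * U * (243 / L ^ 5) ^ (2 * (P.d - 1)) * (2048 / L ^ 7) ^ 2) * L ^ 2)) := by
        apply mul_le_mul_of_nonneg_left _ hLd
        have hL2 : 0 ≤ L ^ 2 := by positivity
        have hb2 := mul_le_mul_of_nonneg_right hb hL2
        linarith only [hm, hb2]
    _ = _ := by ring


/-- ★★ **THE T³ INSTANCE WITH AN ABSOLUTE CONSTANT** (`d = 3`, run `K` of a T³ family, `k = K − n`, `ℓ = L^{K−n} ≥ 4`): for `f` the `Q_{K−n}`-transpose of any coarse weight and `Δ(A ·,μ) = f(·,μ)` on the block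
`B^{K−n}(y)`, `Σ_{B} f⟨x,μ⟩² ≤ C₃·ℓ⁻⁴·Σ_{B} A⟨x,μ⟩²`, `C₃ = 2(36·243⁶ + 2916·243⁴·2048²)∕16⁴` (crude, absolute: ≈ 2.3·10¹⁴). [cite: Balaban1984PropagatorsI, (1.18) p.20, (1.21) p.21, Sect. C p.22;
Balaban1985BackgroundPropagators, Thm 3.11 p.416] -/
theorem sum_block_sq_transpose_le_T3 (F : T3ContinuumYM3Torus.T3Family) (K n : ℕ) (hℓ4 : 4 ≤ F.L ^ (K - n)) (ν : PBond (F.P K) (K - n) → ℝ)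
    (A f : PBond (F.P K) 0 → ℝ)
    (hf : ∀ Y : PBond (F.P K) 0 → ℝ, ∑ c : PBond (F.P K) (K - n), ν c * bondAvgIter (K - n) Y c = ∑ b : PBond (F.P K) 0, f b * Y b)
    (y : Site (F.P K) (K - n)) (μ : Fin (F.P K).d) (hLap : ∀ x ∈ iterBlock (K - n) y, laplace 1 (fun z => A ⟨z, μ⟩) x = f ⟨x, μ⟩) :
    ∑ x ∈ iterBlock (K - n) y, f ⟨x, μ⟩ ^ 2
      ≤ (2 * (36 * 243 ^ 6 + 2916 * 243 ^ 4 * 2048 ^ 2) / 16 ^ 4) / (((F.L : ℝ) ^ (K - n)) ^ 4) * ∑ x ∈ iterBlock (K - n) y, A ⟨x, μ⟩ ^ 2 := by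
  have hk : K - n ≤ (F.P K).m + (F.P K).K := by
    have := F.hm
    show K - n ≤ F.m + K
    omega
  have h := sum_block_sq_transpose_le (P := F.P K) hk hℓ4 ν A f hf y μ hLap
  have hd : (F.P K).d = 3 := rfl
  have hL : ((F.P K).L : ℝ) = F.L := rfl
  rw [hd, hL] at h
  refine h.trans (le_of_eq ?_)
  congr 1
  have hL1 : (1 : ℝ) < F.L := by exact_mod_cast F.hL.2
  have hLpos : (0 : ℝ) < (F.L : ℝ) ^ (K - n) := pow_pos (by linarith) _
  have hLne : ((F.L : ℝ) ^ (K - n)) ≠ 0 := hLpos.ne'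
  norm_num
  field_simp
  ring

end Summit.QuantumFields.YangMills.Theorems.Prop7FlatBlockInverseEstimate

end
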